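import Literature.NumberTheory.GaloisRepresentations.LocalKummerTorsion
import HarnessLib

/-!
# The `(1, 1)` input of the local duality dévissage: `χ ∪ (Kummer class) = κ_χ(β)`

The dévissage `ContinuousRep.dualityPairing_injective_of_devissage` needs, for every discrete
`G`-module `W` of prime order `p` with trivial action, the injectivity of
`a ↦ ι(a ∪ ·) : H¹(G, W) → Hom(H¹(G, W^D), ℤ/n)`, `W^D = Hom(W, μ_n)` (hypothesis `h11`).  This
file provides the cohomological computation behind it, for `G = S ≤ Γ_k` a closed subgroup of the
absolute Galois group of a field `k` of characteristic `0`: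

* `ContinuousRep.exists_eq_oneCocycleClass_homCocycle` — a nonzero `a ∈ H¹(G, W)` is the class of
  `σ ↦ χ̃(σ) w₀` for a cyclic layer `χ : G → ℤ/p` (an onto continuous homomorphism) and a
  generator `w₀` of `W`;
* `kummerLineCocycle` — for `β ∈ (K̄ˣ)^S` and a `p`-th root `r` of `β`, the `1`-cocycle
  `b(σ) = (w ↦ coord(w) · (σ r / r))` of `S` with values in `Hom(W, μ_n)` (`p ∣ n`);
* `kummerTwo_cupProduct_homCocycle_kummerLineCocycle` — **the cochain identity**
  `Kummer(a ∪ b) = κ_χ(β)` in `H²(S, K̄ˣ)`: the cup product cocycle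
  `(σ, τ) ↦ χ̃(σ) · σ(τ r / r)` differs from the carry cocycle `(σ, τ) ↦ c_χ(σ, τ) β` by the
  coboundary of `σ ↦ χ̃(σ) · σ r` (`p c_χ(σ,τ) = χ̃ σ + χ̃ τ - χ̃(στ)`, `r^p = β`).

Hence `a ∪ b ≠ 0` as soon as the cyclic class `κ_χ(β) ∈ Br(E)` is nonzero, which for a local
field is arranged by the structure of `Br(E_χ/E)` (`DualityLineOneLocal.lean`).

## References
* J.-P. Serre, *Corps locaux*, Hermann, 1968, XIV §1–2 (Prop. 2, 5: `(χ, b) = b ∪ δχ`). [SerreLocalFields1979]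
* J.-P. Serre, *Galois Cohomology*, Springer, 1997, II §5.2 (proof of Thm. 2). [SerreGaloisCohomology1997]
-/

noncomputable section

open CategoryTheory Function Field

universe u

namespace Literature.NumberTheory.GaloisRepresentations

open _root_.TopRep _root_.ContRepresentation _root_.ContinuousCohomology DiscreteGaloisModule

/-! ### Classes of `H¹(G, W)` for a line `W` are characters -/

namespace ContinuousRep

section Line

variable {G : Type u} [Group G] [TopologicalSpace G] [IsTopologicalGroup G]
variable {W : Type u} [AddCommGroup W] [TopologicalSpace W] [DiscreteTopology W] [Finite W]
variable (τ : ContinuousRep G ℤ W) (hτ : ∀ (g : G) (w : W), τ g w = w) {p : ℕ} [hp : Fact p.Prime]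
  (hW : Nat.card W = p)

/-- **The crossed homomorphism `σ ↦ χ̃(σ) · w₀`** of a cyclic layer `χ : G → ℤ/p` and `w₀ ∈ W`
(`W` with trivial action, of order `p`): an honest homomorphism `G → W`. [folklore] -/
def homCocycle (χ : CyclicCharacter G p) (w₀ : W) : contOneCocycles τ.toTopRep :=
  ⟨⟨fun σ => (χ σ).val • w₀,
    (continuous_of_discreteTopology (f := fun x : ZMod p => x.val • w₀)).comp χ.continuous⟩, fun g h => by
    change (χ (g * h)).val • w₀ = (χ g).val • w₀ + τ.toTopRep.ρ g ((χ h).val • w₀)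
    rw [toTopRep_ρ_apply, hτ, χ.map_mul, ZMod.val_add, mod_nsmul_eq (card_nsmul_eq_zero_of_card hW w₀),
      add_nsmul]⟩

omit [IsTopologicalGroup G] [Finite W] in
/-- Unfolding `homCocycle`. [folklore] -/
@[simp] theorem homCocycle_apply (χ : CyclicCharacter G p) (w₀ : W) (σ : G) :
    (τ.homCocycle hτ hW χ w₀).1 σ = (χ σ).val • w₀ := rfl

/-- **A nonzero class of `H¹(G, W)` (`W` a line with trivial action) is the class of
`σ ↦ χ̃(σ) w₀`** for a cyclic layer `χ : G → ℤ/p` and a nonzero `w₀`: the class is a nonzero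
continuous homomorphism `f : G → W`, onto since `|W| = p`; `χ = coord ∘ f`, `w₀` a value of `f`.
[cite: SerreGaloisCohomology1997, II §5.2] -/
theorem exists_eq_oneCocycleClass_homCocycle (a : continuousCohomology 1 τ.toTopRep) (ha : a ≠ 0) :
    ∃ (χ : CyclicCharacter G p) (w₀ : W), w₀ ≠ 0 ∧
      a = oneCocycleClass τ.toTopRep (τ.homCocycle hτ hW χ w₀) := by
  classical
  obtain ⟨f, rfl⟩ := oneCocycleClass_surjective _ a
  -- `f` is a homomorphism
  have hf : ∀ g h, f.1 (g * h) = f.1 g + f.1 h := fun g h => by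
    have e := f.2 g h
    rwa [toTopRep_ρ_apply, hτ] at e
  have hfpow : ∀ (g : G) (m : ℕ), f.1 (g ^ m) = m • f.1 g := fun g m => by
    induction m with
    | zero => rw [pow_zero, zero_smul]; exact contOneCocycles.apply_one f
    | succ m ih => rw [pow_succ, hf, ih, add_smul, one_smul]
  -- `f ≠ 0`
  have hne : ∃ g₀, f.1 g₀ ≠ 0 := by
    by_contra h
    have h' : ∀ g, f.1 g = 0 := fun g => Classical.byContradiction fun hg => h ⟨g, hg⟩
    refine ha ((oneCocycleClass_eq_zero_iff _ f).2 ⟨0, fun g => ?_⟩)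
    rw [h', map_zero, sub_zero]
  obtain ⟨g₀, hg₀⟩ := hne
  -- the character `coord ∘ f`
  let cW := lineCoord hW hg₀
  let χ : CyclicCharacter G p :=
    { toFun := fun g => cW (f.1 g)
      map_mul' := fun g h => by rw [hf, map_add]
      continuous_toFun := (continuous_of_discreteTopology (f := cW)).comp f.1.continuous
      surjective' := fun i => ⟨g₀ ^ i.val, by
        change cW (f.1 (g₀ ^ i.val)) = i
        rw [hfpow, map_nsmul, show cW (f.1 g₀) = 1 from lineCoord_self hW hg₀, nsmul_one,
          ZMod.natCast_zmod_val]⟩ }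
  refine ⟨χ, f.1 g₀, hg₀, congrArg _ (Subtype.ext (ContinuousMap.ext fun g => ?_))⟩
  change f.1 g = (cW (f.1 g)).val • f.1 g₀
  rw [val_lineCoord_nsmul]

end Line

end ContinuousRep

/-! ### The Kummer line cocycle of a `p`-th root -/

section KummerLine

variable (k : Type u) [Field k] [CharZero k] (S : Subgroup (absoluteGaloisGroup k))
  [hS : IsClosed (S : Set (absoluteGaloisGroup k))]
variable {p n : ℕ} [hp : Fact p.Prime] (hpn : p ∣ n)

attribute [local instance] compactSpace_of_isClosed_subgroup

/-- An element of `K̄ˣ` whose `n`-th power is `1`, as an element of `μ_n` (`0` otherwise). [folklore] -/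
def toMu (n : ℕ) (u : UnitsCarrier k) : MuCarrier k n := by
  classical
  exact if h : unitsVal k u ^ n = 1 then muOfUnit k n (unitsVal k u) h else 0

omit [CharZero k] in
/-- `kummerι (toMu u) = u` when `u^n = 1`. [folklore] -/
theorem kummerι_toMu {u : UnitsCarrier k} (h : unitsVal k u ^ n = 1) : (kummerι k n).hom (toMu k n u) = u := by
  classical
  apply unitsVal_injective k
  rw [unitsVal_kummerι, toMu, dif_pos h, muVal_muOfUnit]

variable (r β : UnitsCarrier k) (hr : (p : ℤ) • r = β) (hβ : ∀ s : S, units k (s : absoluteGaloisGroup k) β = β)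

omit [CharZero k] hS hp in
include hpn hr hβ in
/-- `(σ r / r)^n = 1` for a `p`-th root `r` of the `S`-invariant `β`, `σ ∈ S`, `p ∣ n`. [folklore] -/
theorem unitsVal_rootQuot_pow (s : S) :
    unitsVal k (units k (s : absoluteGaloisGroup k) r - r) ^ n = 1 := by
  obtain ⟨c, rfl⟩ := hpn
  have hp : unitsVal k (units k (s : absoluteGaloisGroup k) r - r) ^ p = 1 := by
    rw [← zpow_natCast, ← unitsVal_zsmul, smul_sub, ← map_zsmul, hr, hβ s, sub_self]
    rfl
  rw [pow_mul, hp, one_pow]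

/-- **`σ r / r ∈ μ_n`** for a `p`-th root `r` of `β`. [folklore] -/
def rootQuot (s : S) : MuCarrier k n := toMu k n (units k (s : absoluteGaloisGroup k) r - r)

omit [CharZero k] hS hp in
include hpn hr hβ in
/-- `kummerι (σ r / r) = σ r - r`. [folklore] -/
theorem kummerι_rootQuot (s : S) :
    (kummerι k n).hom (rootQuot k S r s) = units k (s : absoluteGaloisGroup k) r - r :=
  kummerι_toMu k (unitsVal_rootQuot_pow k S hpn r β hr hβ s)

omit [CharZero k] hS hp in
include hpn hr hβ in
/-- **`σ r / r` is a `1`-cocycle of `S` with values in `μ_n`.** [folklore] -/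
theorem rootQuot_mul (hn : 0 < n) (s t : S) :
    rootQuot k S r (s * t) = rootQuot k S r s + (mu k n).restrict (subgroupIncl S) s (rootQuot k S r t) := by
  apply (isSES_kummer k n hn).injective
  change (kummerι k n).hom _ = (kummerι k n).hom _
  rw [map_add, kummerι_rootQuot k S hpn r β hr hβ, ContinuousRep.restrict_apply, subgroupIncl_apply,
    ContinuousRep.hom_comm_apply (kummerι k n), kummerι_rootQuot k S hpn r β hr hβ,
    kummerι_rootQuot k S hpn r β hr hβ, Subgroup.coe_mul, map_mul, map_sub]
  change units k s (units k t r) - r = units k s r - r + (units k s (units k t r) - units k s r)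
  abel

omit [CharZero k] hS hp in
include hpn hr hβ in
/-- `p · (σ r / r) = 0` in `μ_n`. [folklore] -/
theorem nsmul_rootQuot (hn : 0 < n) (s : S) : p • (rootQuot k S r s : MuCarrier k n) = 0 := by
  apply (isSES_kummer k n hn).injective
  change (kummerι k n).hom _ = (kummerι k n).hom 0
  rw [map_nsmul, kummerι_rootQuot k S hpn r β hr hβ, map_zero, ← natCast_zsmul, smul_sub, ← map_zsmul, hr,
    hβ s, sub_self]

omit [CharZero k] hS hp in
/-- `σ ↦ σ r / r` is continuous (`S → μ_n` discrete). [folklore] -/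
theorem continuous_rootQuot : Continuous (rootQuot k S r : S → MuCarrier k n) :=
  (continuous_of_discreteTopology (f := toMu k n)).comp
    ((((units k).continuous_apply_left r).comp continuous_subtype_val).sub continuous_const)

variable {W : Type u} [AddCommGroup W] [TopologicalSpace W] [DiscreteTopology W] [Finite W]
variable (τ : ContinuousRep S ℤ W) (hτ : ∀ (g : S) (w : W), τ g w = w) (hW : Nat.card W = p)
  {w₀ : W} (hw₀ : w₀ ≠ 0)

/-- `σ r / r` as an element of `μ_n[p]`. [folklore] -/
def rootQuotTorsion (hn : 0 < n) (s : S) : Submodule.torsionBy ℤ (MuCarrier k n) (p : ℤ) :=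
  ⟨rootQuot k S r s, nsmul_rootQuot k S hpn r β hr hβ hn s⟩

/-- **The Kummer line cocycle** `b(σ) = (w ↦ coord(w) · (σ r / r)) ∈ Hom(W, μ_n)` of a `p`-th root
`r` of `β ∈ (K̄ˣ)^S`: a `1`-cocycle of `S` with values in `W^D = Hom(W, μ_n)` (through
`Hom(W, μ_n) ≅ μ_n[p]`, `lineHomEquiv`). [cite: SerreLocalFields1979, XIV §2] -/
def kummerLineCocycle (hn : 0 < n) :
    contOneCocycles ((τ.homRep ((mu k n).restrict (subgroupIncl S))).toTopRep) :=
  ⟨⟨fun s => (ContinuousRep.lineHomEquiv (Ω := MuCarrier k n) hW hw₀).symm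
      (rootQuotTorsion k S hpn r β hr hβ hn s),
    (ContinuousRep.lineHomEquiv (Ω := MuCarrier k n) hW hw₀).symm.continuous.comp
      ((continuous_rootQuot k S r).subtype_mk _)⟩, fun s t => by
    have hcoc : rootQuotTorsion k S hpn r β hr hβ hn (s * t) =
        rootQuotTorsion k S hpn r β hr hβ hn s +
          ((mu k n).restrict (subgroupIncl S)).torsionRep p s (rootQuotTorsion k S hpn r β hr hβ hn t) :=
      Subtype.ext (rootQuot_mul k S hpn r β hr hβ hn s t)
    change (ContinuousRep.lineHomEquiv hW hw₀).symm (rootQuotTorsion k S hpn r β hr hβ hn (s * t)) =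
      (ContinuousRep.lineHomEquiv hW hw₀).symm (rootQuotTorsion k S hpn r β hr hβ hn s) +
        (τ.homRep ((mu k n).restrict (subgroupIncl S))).toTopRep.ρ s
          ((ContinuousRep.lineHomEquiv hW hw₀).symm (rootQuotTorsion k S hpn r β hr hβ hn t))
    rw [hcoc, map_add]
    congr 1
    apply (ContinuousRep.lineHomEquiv (Ω := MuCarrier k n) hW hw₀).injective
    rw [ContinuousLinearEquiv.apply_symm_apply]
    apply Subtype.ext
    change _ = ((τ.homRep ((mu k n).restrict (subgroupIncl S))) s
      ((ContinuousRep.lineHomEquiv hW hw₀).symm (rootQuotTorsion k S hpn r β hr hβ hn t))) w₀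
    rw [ContinuousRep.homRep_apply_apply_apply, hτ]
    change _ = (mu k n).restrict (subgroupIncl S) s
      (((ContinuousRep.lineHomEquiv (Ω := MuCarrier k n) hW hw₀)
        ((ContinuousRep.lineHomEquiv hW hw₀).symm (rootQuotTorsion k S hpn r β hr hβ hn t)) : _) : MuCarrier k n)
    rw [ContinuousLinearEquiv.apply_symm_apply]
    rfl⟩

omit [CharZero k] hS in
/-- The Kummer line cocycle evaluated at `w₀` is `σ r / r`. [folklore] -/
theorem kummerLineCocycle_apply_self (hn : 0 < n) (s : S) :
    ((kummerLineCocycle k S hpn r β hr hβ τ hτ hW hw₀ hn).1 s : HomCarrier W (MuCarrier k n)) w₀ =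
      rootQuot k S r s := by
  change (ContinuousRep.lineCoord hW hw₀ w₀).val • rootQuot k S r s = rootQuot k S r s
  rw [ContinuousRep.lineCoord_self, ZMod.val_one, one_nsmul]

/-! ### The cochain identity `Kummer(χ ∪ b) = κ_χ(β)` -/

/-- The linear-combination identity behind the cochain computation. [folklore] -/
theorem carry_smul_identity {M : Type*} [AddCommGroup M] (A B : M) (a b c : ℕ) (carry q : ℤ)
    (h : q * carry = a + b - c) :
    (a : ℤ) • (A - B) - carry • (q • A) = -((b : ℤ) • A) - (-((c : ℤ) • A)) + (-((a : ℤ) • B)) := by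
  rw [smul_smul, mul_comm, h, sub_smul, add_smul, smul_sub]
  abel

/-- **The cochain identity `Kummer(a ∪ b) = κ_χ(β)`**: for a cyclic layer `χ : S → ℤ/p`, a line
`W` (trivial action, order `p`, generator `w₀`), `β ∈ (K̄ˣ)^S` with `p`-th root `r`, the image in
`H²(S, K̄ˣ)` of the cup product of `a = [σ ↦ χ̃(σ) w₀] ∈ H¹(S, W)` with the Kummer line class
`b = [σ ↦ (w ↦ coord(w)(σ r/r))] ∈ H¹(S, Hom(W, μ_n))` (evaluation pairing `W × Hom(W, μ_n) → μ_n`)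
is the cyclic class `κ_χ(β)`: the cup product cocycle `(σ, τ) ↦ χ̃(σ) · σ(τ r / r)` and the carry
cocycle `(σ, τ) ↦ c_χ(σ, τ) β` differ by the coboundary of `σ ↦ -χ̃(σ) · σ r`.
[cite: SerreLocalFields1979, XIV §1 Prop. 2 and §2 Prop. 5] -/
theorem kummerTwo_cupProduct_eq_cyclicClass (hn : 0 < n) (χ : CyclicCharacter S p) :
    kummerTwo k S n ((τ.evalPairing ((mu k n).restrict (subgroupIncl S))).cupProduct
        (oneCocycleClass _ (τ.homCocycle hτ hW χ w₀))
        (oneCocycleClass _ (kummerLineCocycle k S hpn r β hr hβ τ hτ hW hw₀ hn))) =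
      cyclicClass χ ((units k).restrict (subgroupIncl S)) ⟨β, fun s => hβ s⟩ := by
  rw [ContPairing.cupProduct_oneCocycleClass_eq_twoCocycleClass, cyclicClass_apply]
  change cohomologyMap (resModHom S (kummerι k n)) 2 _ = _
  rw [cohomologyMap_twoCocycleClass, ← sub_eq_zero, ← twoCocycleClass_sub, twoCocycleClass_eq_zero_iff]
  -- the coboundary witness `σ ↦ -χ̃(σ) · σ r`
  refine ⟨⟨fun s => -((χ s).val • units k (s : absoluteGaloisGroup k) r),
    (continuous_of_discreteTopology (f := fun q : ZMod p × UnitsCarrier k => -(q.1.val • q.2))).comp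
      (χ.continuous.prodMk (((units k).continuous_apply_left r).comp continuous_subtype_val))⟩,
    fun σ υ => ?_⟩
  -- both sides, explicitly
  have hL : ((contTwoCocycles.pullback (ContinuousMonoidHom.id S) (resIdHom (resModHom S (kummerι k n)))
      ((τ.evalPairing ((mu k n).restrict (subgroupIncl S))).cupCocycle (τ.homCocycle hτ hW χ w₀)
        (kummerLineCocycle k S hpn r β hr hβ τ hτ hW hw₀ hn))).1 (σ, υ)) =
      (χ σ).val • (units k (σ : absoluteGaloisGroup k) (units k (υ : absoluteGaloisGroup k) r) -
        units k (σ : absoluteGaloisGroup k) r) := by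
    rw [pullback₂_id_resIdHom_apply, resModHom_hom_apply]
    change (kummerι k n).hom ((τ.evalPairing ((mu k n).restrict (subgroupIncl S))).toLin
      ((τ.homCocycle hτ hW χ w₀).1 σ)
      ((kummerLineCocycle k S hpn r β hr hβ τ hτ hW hw₀ hn).1 (σ * υ) -
        (kummerLineCocycle k S hpn r β hr hβ τ hτ hW hw₀ hn).1 σ)) = _
    rw [ContinuousRep.evalPairing_toLin_apply, ContinuousRep.homCocycle_apply, map_nsmul,
      HomCarrier.sub_apply, kummerLineCocycle_apply_self, kummerLineCocycle_apply_self,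
      rootQuot_mul k S hpn r β hr hβ hn σ υ, add_sub_cancel_left, map_nsmul,
      ContinuousRep.restrict_apply, subgroupIncl_apply, ContinuousRep.hom_comm_apply (kummerι k n),
      kummerι_rootQuot k S hpn r β hr hβ, map_sub]
  have hR : (carryCocycle χ ((units k).restrict (subgroupIncl S)) β (fun s => hβ s)).1 (σ, υ) =
      χ.carryFun σ υ • ((p : ℤ) • units k (σ : absoluteGaloisGroup k) (units k (υ : absoluteGaloisGroup k) r)) := by
    rw [carryCocycle_apply]
    congr 1
    rw [← map_zsmul, ← map_zsmul, hr, hβ υ, hβ σ]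
  change (contTwoCocycles.pullback (ContinuousMonoidHom.id S) (resIdHom (resModHom S (kummerι k n)))
      ((τ.evalPairing ((mu k n).restrict (subgroupIncl S))).cupCocycle (τ.homCocycle hτ hW χ w₀)
        (kummerLineCocycle k S hpn r β hr hβ τ hτ hW hw₀ hn))).1 (σ, υ) -
      (carryCocycle χ ((units k).restrict (subgroupIncl S)) β (fun s => hβ s)).1 (σ, υ) =
    ((units k).restrict (subgroupIncl S)).toTopRep.ρ σ
        (-((χ υ).val • units k (υ : absoluteGaloisGroup k) r)) -
      (-((χ (σ * υ)).val • units k ((σ * υ : S) : absoluteGaloisGroup k) r)) +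
      (-((χ σ).val • units k (σ : absoluteGaloisGroup k) r))
  rw [hL, hR, ContinuousRep.toTopRep_ρ_apply, ContinuousRep.restrict_apply, subgroupIncl_apply, map_neg,
    map_nsmul, Subgroup.coe_mul, map_mul]
  change _ = -((χ υ).val • units k (σ : absoluteGaloisGroup k) (units k (υ : absoluteGaloisGroup k) r)) -
      (-((χ (σ * υ)).val • units k (σ : absoluteGaloisGroup k) (units k (υ : absoluteGaloisGroup k) r))) +
      (-((χ σ).val • units k (σ : absoluteGaloisGroup k) r))
  rw [← natCast_zsmul, ← natCast_zsmul, ← natCast_zsmul, ← natCast_zsmul]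
  exact carry_smul_identity _ _ _ _ _ _ _ (χ.natCast_mul_carryFun σ υ)

end KummerLine

end Literature.NumberTheory.GaloisRepresentations

end
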